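/-
Chen 2024 (IACR ePrint 2024/555, version of 2024-04-18), §3.5.3–§3.5.4 pp. 24–26: Step 3 (the complex
Gaussian window centred at the measured `z′`, eq. (19)–(21)) and Step 4 (`|φ₄⟩ := QFT_{ℤ_Pⁿ}|φ₃⟩`, eq. (24))
EXACTLY, for the untruncated states: `|φ₃⟩ = f₂ · (window of (21))` with `f₂ = QFT_{ℤ_Pⁿ}|φ′₁⟩` the exact
Step-2 state of `ChenQuantumLWEKarstWave` (eq. (18)), and `|φ₄⟩ = QFT_{ℤ_Pⁿ}|φ₃⟩` in two closed forms:
(T1) "line ⊛ dual window" — the finite convolution theorem on `ℤ_Pⁿ` plus ONE-dimensional Poisson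
summation per coordinate (no `n`-dimensional Poisson summation is needed), and (T2) the printed eq. (24)
(sum over `m ∈ ℤⁿ` outside, `j ∈ ℤ` inside, the form `Σ = t⁻²(I − xxᵀ/(t²+‖x‖²))`, `d_j`, `C_j` of (23)),
with the global constant the paper drops made explicit.  Kernel-checked instances of Jacobi's imaginary
transformation (Mathlib `Complex.tsum_exp_neg_quadratic`) and of Fubini on `ℤ × ℤⁿ`.

REPRODUCTION / ANALYSIS OF A CLAIMED RESULT UNDER ADJUDICATION (withdrawn by its author, note of 2024-04-18).
HONEST FRAMING: the VALUE is a THEOREM / DECIDABLE VERDICT / CERTIFICATE / precise negative result — NOT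
summit progress.  Theorems about a WITHDRAWN algorithm: they certify that eq. (24) is CORRECT as an exact
identity for the untruncated states (the defect of the paper is elsewhere: the periodicity premise of
Lemma 2.17 in Step 9, `ChenQuantumLWESteps`); nothing is repaired, nothing is broken, no cryptanalytic
claim.  The `≈_t` truncations (Lemma 3.20, the `V log n · B_∞ⁿ` support of (19)) are NOT treated.
No named fact is introduced (debt 0).
-/
import Literature.Computability.Cryptography.ChenQuantumLWEKarstWave
import Literature.Computability.Cryptography.ChenQuantumLWEBornRule

/-!
# Chen 2024, Steps 3–4: the window at `z′` and `|φ₄⟩ = QFT_{ℤ_Pⁿ}|φ₃⟩` (eq. (19)–(24)) — exactly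

Setting (§3.5.3, p. 24–25).  After Step 2 the registers hold `|φ₂⟩ = Σ_{z∈ℤ_Pⁿ} f₂(z)|z⟩` with
`f₂ = QFT_{ℤ_Pⁿ}|φ′₁⟩` (`qft (phi1Prime P a x y)`, eq. (18), `ChenQuantumLWEKarstWave`; rate
`a = κ_{r,s} = 1/r² + i/s²`).  Step 3 appends the complex Gaussian state (19) of rate
`b = t²r²s²(s²−r²i)/(P²u²(s⁴+r⁴)) = t²/(P²‖x‖²a)` (with the correct guess `u² = ‖x‖²`), adds, and measures
`z′`; the residual state is (21): `|φ₃⟩ = Σ_{z∈ℤⁿ} f₂(z) e^{−πb‖z−z′‖²}|z mod P⟩`, i.e. — `f₂` being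
`P`-periodic — the amplitude of `v ∈ ℤ_Pⁿ` is `f₂(v) · ∏ᵢ Σ_{m∈ℤ} e^{−πb(ṽᵢ + Pm − z′ᵢ)²}` (`window`,
`phi3`; `ṽ` the representative in `[0,P)`).  Step 4 is `|φ₄⟩ := QFT_{ℤ_Pⁿ}|φ₃⟩` (`phi4`).

Results (all exact, all constants explicit):
* `qft_qft_mul` — the finite convolution theorem `QFT(QFT φ · G)(h) = Σ_v φ(v)·(QFT G)(h+v)`;
  `qft_pi` — `QFT` of a product state is the product of the one-register transforms. [folklore]
* `sum_pgauss_mul_stdAddChar` — the one-register transform of the periodised window is the DUAL WINDOW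
  `b^{-1/2} Σ_{j∈ℤ} e^{−(π/b)(j+u/P)²} e^{−2πi z′ᵢ(j+u/P)}` (`dualWindow`; Lemma 2.4 + eq. (1), centre = phase).
* `phi4_apply` (T1) — `|φ₄⟩(h) = b^{-n/2} Σ_{k∈ℤ} e^{−πa‖kx−y‖²} ∏ᵢ dualWindowᵢ((h̃ᵢ + kxᵢ − yᵢ)/P)`:
  the line state of Step 1 read through the dual window ("line ⊛ dual window").
* `phi4_eq24` (T2) — eq. (24) as printed (p. 26, the display `=(a)`: sum over `m ∈ ℤⁿ` of the Gaussian
  of `Σ` at `m + h/P + ⟨x,y⟩x/(‖x‖²P) − y/P`, times the `j`-series with `d_j`, `C_j`; the paper's last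
  display merely rescales `m ↦ Pm`), with the global constant `e^{−πa(‖y‖²−⟨x,y⟩²/‖x‖²)} · b^{-n/2} ·
  α^{-1/2}`, `α = a‖x‖²(t²+‖x‖²)/t²`, in front.  The paper's step "(a) uses PSF from `Σ_{z∈ℤⁿ}` to
  `Σ_{m∈ℤⁿ}`" is certified WITHOUT an `n`-dimensional Poisson summation: from T1 by Fubini on `ℤ × ℤⁿ`
  and one more one-dimensional Poisson summation in `k`; the exponents then agree with (22)–(24)
  identically (`eq24_exponent_identity`, which contains Lemma 3.21's completed square and (23)(b)).

[cite: ChenQuantumLattice2024, §3.5.3–3.5.4, eq. (19)–(24), p. 24–26; Lemma 2.4 p. 10; Lemma 2.12 p. 12]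
-/

namespace Literature.Computability.Cryptography.Chen2024

open scoped BigOperators Real
open Complex hiding exp continuous_exp exp_add

noncomputable section

section StepFour

variable {n : ℕ}

/-! ### Finite Fourier algebra on `ℤ_Pⁿ`: convolution theorem and product states -/

/-- A character turns sums into products: `ψ_P(Σ_t c_t) = ∏_t ψ_P(c_t)` (local copy of the helper of
`ChenQuantumLWEStepEight`, kept private to avoid the import). [folklore] -/
private theorem stdAddChar_finsetSum {P : ℕ} [NeZero P] {ι : Type*} (s : Finset ι) (c : ι → ZMod P) :
    ZMod.stdAddChar (∑ t ∈ s, c t) = ∏ t ∈ s, ZMod.stdAddChar (c t) := by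
  classical
  induction s using Finset.induction_on with
  | empty => simp
  | insert a s ha ih => rw [Finset.sum_insert ha, Finset.prod_insert ha, AddChar.map_add_eq_mul, ih]

/-- **Finite convolution theorem for Chen's `QFT_{ℤ_Pⁿ}`** (Lemma 2.12, unnormalised, kernel
`e^{−2πi⟨z,u⟩/P}`): transforming a pointwise product whose first factor is itself a transform gives
`QFT(QFT φ · G)(h) = Σ_{v∈ℤ_Pⁿ} φ(v) · (QFT G)(h + v)` (i.e. `QFT²φ = Pⁿ·φ∘neg` convolved with `QFT G`).
[folklore] [cite: ChenQuantumLattice2024, Lemma 2.12 p. 12] -/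
theorem qft_qft_mul {P : ℕ} [NeZero P] (φ G : Ket n P) (h : Fin n → ZMod P) :
    qft (fun z => qft φ z * G z) h = ∑ v, φ v * qft G (h + v) := by
  have key : ∀ v z : Fin n → ZMod P,
      ZMod.stdAddChar (-(∑ t, v t * z t)) * ZMod.stdAddChar (-(∑ t, z t * h t))
        = ZMod.stdAddChar (-(∑ t, z t * (h + v) t)) := by
    intro v z
    rw [← AddChar.map_add_eq_mul]
    congr 1
    simp only [Pi.add_apply, mul_add, Finset.sum_add_distrib, mul_comm (z _) (v _)]
    ring
  rw [qft_apply_eq_sum_stdAddChar]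
  simp_rw [qft_apply_eq_sum_stdAddChar, Finset.sum_mul, Finset.mul_sum]
  rw [Finset.sum_comm]
  refine Finset.sum_congr rfl fun v _ => Finset.sum_congr rfl fun z _ => ?_
  rw [← key v z]
  ring

/-- **`QFT_{ℤ_Pⁿ}` of a product state** `⊗ᵢ gᵢ` is the product of the one-register transforms
`∏ᵢ Σ_{w∈ℤ_P} gᵢ(w) ψ_P(−w·uᵢ)`. [folklore] [cite: ChenQuantumLattice2024, Lemma 2.12 p. 12] -/
theorem qft_pi {P : ℕ} [NeZero P] (g : Fin n → ZMod P → ℂ) (u : Fin n → ZMod P) :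
    qft (fun z => ∏ i, g i (z i)) u = ∏ i, ∑ w : ZMod P, g i w * ZMod.stdAddChar (-(w * u i)) := by
  classical
  rw [qft_apply_eq_sum_stdAddChar]
  have h1 : ∀ z : Fin n → ZMod P, (∏ i, g i (z i)) * ZMod.stdAddChar (-(∑ t, z t * u t))
      = ∏ i, (g i (z i) * ZMod.stdAddChar (-(z i * u i))) := by
    intro z
    rw [← Finset.sum_neg_distrib, stdAddChar_finsetSum, ← Finset.prod_mul_distrib]
  simp_rw [h1]
  rw [← Fintype.piFinset_univ, ← Finset.prod_univ_sum (fun _ => (Finset.univ : Finset (ZMod P)))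
    (fun i w => g i w * ZMod.stdAddChar (-(w * u i)))]

/-! ### The window of Step 3 (eq. (19)–(21)) and its one-register transform -/

/-- One coordinate of the Step-3 window, read on `ℤ_P`: the periodised complex Gaussian of rate `b` centred
at the integer `c` (`= z′ᵢ`), `w ↦ Σ_{m∈ℤ} e^{−πb(w̃ + Pm − c)²}` (`w̃ ∈ [0,P)`; eq. (21): "`Σ_{z∈ℤⁿ} … |z mod P⟩`").
[cite: ChenQuantumLattice2024, eq. (19)–(21) p. 24–25] -/
def pgauss (P : ℕ) (b : ℂ) (c : ℤ) (w : ZMod P) : ℂ :=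
  ∑' m : ℤ, cexp (-π * b * ((((w.val : ℤ) + P * m : ℤ) : ℂ) - c) ^ 2)

/-- The DUAL WINDOW: `D_{b,c}(s) := Σ_{j∈ℤ} e^{−(π/b)(j+s)²} e^{−2πic(j+s)}` — Poisson summation of the window
of rate `b` centred at `c`, the centre having become a phase ("center = phase", eq. (1)–(2)).
[cite: ChenQuantumLattice2024, §1.2 eq. (1)–(2) p. 3; Lemma 2.4 p. 10] -/
def dualWindow (b : ℂ) (c : ℤ) (s : ℂ) : ℂ :=
  ∑' j : ℤ, cexp (-π / b * (j + s) ^ 2) * cexp (-2 * π * I * c * (j + s))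

/-- The Gaussian `m ↦ e^{−πb(m−c)²}` is absolutely summable over `ℤ` for `Re b > 0`. [folklore] -/
theorem summable_gaussZ {b : ℂ} (hb : 0 < b.re) (c : ℂ) :
    Summable fun m : ℤ => cexp (-π * b * ((m : ℂ) - c) ^ 2) := by
  refine ((summable_cexp_neg_quadratic hb (b * c)).mul_left (cexp (-π * b * c ^ 2))).congr
    fun m => ?_
  rw [← Complex.exp_add]
  congr 1
  ring

/-- **One register of Step 3 through `QFT_{ℤ_P}`.**  For `Re b > 0`, `c ∈ ℤ`, `u ∈ ℤ_P` (read in `[0,P)`):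
`Σ_{w∈ℤ_P} (Σ_m e^{−πb(w̃+Pm−c)²}) ψ_P(−wu) = b^{−1/2} · D_{b,c}(u/P)` — `qft_periodised` (sum over `ℤ` by
residues) followed by the master identity `tsum_cexp_neg_quadratic_shift` (Lemma 2.4 + eq. (1)).
[cite: ChenQuantumLattice2024, Lemma 2.4 p. 10; §1.2 eq. (1)–(2) p. 3; eq. (21) p. 25] -/
theorem sum_pgauss_mul_stdAddChar {P : ℕ} [NeZero P] {b : ℂ} (hb : 0 < b.re) (c : ℤ) (u : ZMod P) :
    ∑ w : ZMod P, pgauss P b c w * ZMod.stdAddChar (-(w * u))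
      = 1 / b ^ (1 / 2 : ℂ) * dualWindow b c ((u.val : ℂ) / P) := by
  have hχ : ∀ w : ZMod P, e (-(((w.val * u.val : ℕ) : ℚ) / P)) = ZMod.stdAddChar (-(w * u)) := by
    intro w
    rw [e_neg_natCast_div]
    simp [ZMod.natCast_val, ZMod.cast_id']
  calc ∑ w : ZMod P, pgauss P b c w * ZMod.stdAddChar (-(w * u))
      = ∑ w : ZMod P, (∑' m : ℤ, cexp (-π * b * ((((w.val : ℤ) + P * m : ℤ) : ℂ) - c) ^ 2))
          * e (-(((w.val * u.val : ℕ) : ℚ) / P)) := by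
        simp_rw [pgauss, hχ]
    _ = ∑' k : ℤ, cexp (-π * b * ((k : ℂ) - c) ^ 2) * cexp (-2 * π * I * k * u.val / P) :=
        qft_periodised P (summable_gaussZ hb c) u
    _ = ∑' k : ℤ, cexp (-π * b * ((k : ℂ) - c) ^ 2) * cexp (-2 * π * I * k * ((u.val : ℂ) / P)) := by
        refine tsum_congr fun k => ?_
        congr 2
        ring
    _ = 1 / b ^ (1 / 2 : ℂ) * dualWindow b c ((u.val : ℂ) / P) := by
        rw [dualWindow, tsum_cexp_neg_quadratic_shift hb]

/-- The dual window only depends on `s mod 1`: `D_{b,c}(s + t) = D_{b,c}(s)` for `t ∈ ℤ` (reindex `j ↦ j+t`).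
[folklore] -/
theorem dualWindow_add_int (b : ℂ) (c : ℤ) (s : ℂ) (t : ℤ) :
    dualWindow b c (s + t) = dualWindow b c s := by
  unfold dualWindow
  conv_rhs => rw [← (Equiv.addRight t).tsum_eq]
  refine tsum_congr fun j => ?_
  simp only [Equiv.coe_addRight, Int.cast_add]
  congr 1
  · congr 1
    ring
  · congr 1
    ring

/-- Reading `h + (m mod P)` in `[0,P)` instead of `h̃ + m` changes the argument of the dual window by an
integer, hence not its value. [folklore] -/
theorem dualWindow_val_add {P : ℕ} [NeZero P] (b : ℂ) (c : ℤ) (h : ZMod P) (m : ℤ) :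
    dualWindow b c ((((h + (m : ZMod P)).val : ℕ) : ℂ) / P)
      = dualWindow b c ((((h.val : ℤ) + m : ℤ) : ℂ) / P) := by
  obtain ⟨t, ht⟩ : ∃ t : ℤ, (((h + (m : ZMod P)).val : ℤ)) = (h.val : ℤ) + m + P * t := by
    have h1 : ((((h + (m : ZMod P)).val : ℤ)) : ZMod P) = (((h.val : ℤ) + m : ℤ) : ZMod P) := by
      simp only [Int.cast_add, ZMod.natCast_val, ZMod.intCast_cast, ZMod.cast_id', id_eq]
    obtain ⟨t, ht⟩ := (ZMod.intCast_eq_intCast_iff_dvd_sub _ _ _).mp h1.symm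
    exact ⟨t, by linarith⟩
  have hP : (P : ℂ) ≠ 0 := by exact_mod_cast NeZero.ne P
  have key : ((((h + (m : ZMod P)).val : ℕ) : ℂ) / P) = ((((h.val : ℤ) + m : ℤ) : ℂ) / P) + (t : ℤ) := by
    have ht' := congrArg (fun z : ℤ => (z : ℂ)) ht
    push_cast at ht' ⊢
    rw [ht']
    field_simp
  rw [key, dualWindow_add_int]

/-- **The Step-3 window on `ℤ_Pⁿ`** (eq. (21), the factor multiplying `f₂`): `z ↦ ∏ᵢ Σ_{m∈ℤ}
e^{−πb(z̃ᵢ + Pm − z′ᵢ)²} = Σ_{m∈ℤⁿ} e^{−πb‖z̃ + Pm − z′‖²}`, rate `b` (`= t²r²s²(s²−r²i)/(P²u²(s⁴+r⁴))`), centre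
the measured `z′ ∈ ℤⁿ`.  The paper's `|φ_G⟩` (19) is truncated to `V log n · B_∞ⁿ`; here it is not.
[cite: ChenQuantumLattice2024, eq. (19)–(21) p. 24–25] -/
def window (P : ℕ) (b : ℂ) (z' : Fin n → ℤ) : Ket n P :=
  fun z => ∏ i, pgauss P b (z' i) (z i)

/-- **`|φ₃⟩`** (eq. (21), untruncated): amplitude of `z` = `f₂(z) · window(z)` with `f₂ = QFT_{ℤ_Pⁿ}|φ′₁⟩`
the exact Step-2 state (eq. (18)). [cite: ChenQuantumLattice2024, eq. (21) p. 25] -/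
def phi3 (P : ℕ) [NeZero P] (a b : ℂ) (x y z' : Fin n → ℤ) : Ket n P :=
  fun z => qft (phi1Prime P a x y) z * window P b z' z

/-- **`|φ₄⟩ := QFT_{ℤ_Pⁿ}|φ₃⟩`** (Step 4, §3.5.4 p. 25). [cite: ChenQuantumLattice2024, §3.5.4 p. 25] -/
def phi4 (P : ℕ) [NeZero P] (a b : ℂ) (x y z' : Fin n → ℤ) : Ket n P :=
  qft (phi3 P a b x y z')

/-- **`QFT_{ℤ_Pⁿ}` of the window** is the product of dual windows: `(QFT window)(u) = b^{−n/2} ∏ᵢ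
D_{b,z′ᵢ}(ũᵢ/P)`. [cite: ChenQuantumLattice2024, Lemma 2.4 p. 10; eq. (21) p. 25] -/
theorem qft_window {P : ℕ} [NeZero P] {b : ℂ} (hb : 0 < b.re) (z' : Fin n → ℤ) (u : Fin n → ZMod P) :
    qft (window P b z') u
      = (1 / b ^ (1 / 2 : ℂ)) ^ n * ∏ i, dualWindow b (z' i) (((u i).val : ℂ) / P) := by
  unfold window
  rw [qft_pi (fun i => pgauss P b (z' i)) u]
  simp_rw [sum_pgauss_mul_stdAddChar hb]
  rw [Finset.prod_mul_distrib, Finset.prod_const, Finset.card_univ, Fintype.card_fin]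

/-- Pairing `|φ′₁⟩` with any test function collapses to the line: `Σ_v φ′₁(v) c(v) = Σ_{k∈ℤ}
e^{−πa‖kx−y‖²} c(kx − y mod P)` (fibrewise resummation; `x ≠ 0`, `Re a > 0`).
[cite: ChenQuantumLattice2024, §3.5.1 p. 23] -/
theorem sum_phi1Prime_mul {P : ℕ} [NeZero P] {a : ℂ} (ha : 0 < a.re) {x : Fin n → ℤ} (hx : x ≠ 0)
    (y : Fin n → ℤ) (c : (Fin n → ZMod P) → ℂ) :
    ∑ v, phi1Prime P a x y v * c v
      = ∑' k : ℤ, cexp (-π * a * ∑ i, ((k * x i - y i : ℤ) : ℂ) ^ 2) *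
          c (fun i => ((k * x i - y i : ℤ) : ZMod P)) := by
  classical
  set F : ℤ → ℂ := fun k => cexp (-π * a * ∑ i, ((k * x i - y i : ℤ) : ℂ) ^ 2) with hFdef
  set pr : ℤ → (Fin n → ZMod P) := fun k i => ((k * x i - y i : ℤ) : ZMod P) with hprdef
  have hF : Summable F := summable_lineWindow ha hx y
  have step1 : ∑ v, phi1Prime P a x y v * c v = ∑ v, ∑' k, (if pr k = v then F k * c v else 0) := by
    refine Finset.sum_congr rfl fun v _ => ?_
    simp only [phi1Prime, hFdef, hprdef]
    rw [← tsum_mul_right]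
    refine tsum_congr fun k => ?_
    split_ifs <;> simp
  have step2 : ∑ v, ∑' k, (if pr k = v then F k * c v else 0)
      = ∑' k, ∑ v, (if pr k = v then F k * c v else 0) := by
    refine (Summable.tsum_finsetSum fun v _ => ?_).symm
    refine ((hF.mul_right (c v)).indicator {k | pr k = v}).congr fun k => ?_
    by_cases h : pr k = v <;> simp [h]
  rw [step1, step2]
  refine tsum_congr fun k => ?_
  rw [Finset.sum_ite_eq, if_pos (Finset.mem_univ _)]

/-- **T1 — `|φ₄⟩` as "line ⊛ dual window" (Step 4, exactly).**  For `Re a, Re b > 0`, `x ≠ 0`: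
`|φ₄⟩(h) = b^{−n/2} Σ_{k∈ℤ} e^{−πa‖kx−y‖²} ∏ᵢ D_{b,z′ᵢ}((h̃ᵢ + kxᵢ − yᵢ)/P)` (`h̃ᵢ ∈ [0,P)` the
representative; any representative gives the same value, `dualWindow_add_int`).  Ingredients: the finite
convolution theorem (`qft_qft_mul`), the product structure of the window (`qft_window`), and the fibrewise
resummation of `|φ′₁⟩` (`sum_phi1Prime_mul`).  No `n`-dimensional Poisson summation is used.
[cite: ChenQuantumLattice2024, §3.5.4 eq. (24) p. 25–26; eq. (18), (21)] -/
theorem phi4_apply {P : ℕ} [NeZero P] {a b : ℂ} (ha : 0 < a.re) (hb : 0 < b.re) {x : Fin n → ℤ}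
    (hx : x ≠ 0) (y z' : Fin n → ℤ) (h : Fin n → ZMod P) :
    phi4 P a b x y z' h = (1 / b ^ (1 / 2 : ℂ)) ^ n *
      ∑' k : ℤ, cexp (-π * a * ∑ i, ((k * x i - y i : ℤ) : ℂ) ^ 2) *
        ∏ i, dualWindow b (z' i) (((((h i).val : ℤ) + (k * x i - y i) : ℤ) : ℂ) / P) := by
  unfold phi4 phi3
  rw [qft_qft_mul, sum_phi1Prime_mul ha hx y]
  simp_rw [qft_window hb]
  rw [← tsum_mul_left]
  refine tsum_congr fun k => ?_
  rw [mul_left_comm]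
  congr 2
  refine Finset.prod_congr rfl fun i _ => ?_
  simp only [Pi.add_apply]
  exact dualWindow_val_add b (z' i) (h i) (k * x i - y i)


/-! ### From T1 to the printed eq. (24): products of series, Fubini on `ℤ × ℤⁿ`, Poisson summation in `k` -/

/-- One term of the dual window: `D_{b,c}(s) = Σ_j dualTerm b c s j`. [folklore] -/
def dualTerm (b : ℂ) (c : ℤ) (s : ℂ) (j : ℤ) : ℂ :=
  cexp (-π / b * (j + s) ^ 2) * cexp (-2 * π * I * c * (j + s))

/-- `D_{b,c}(s) = Σ_j dualTerm b c s j` (definitional). [folklore] -/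
theorem dualWindow_eq_tsum (b : ℂ) (c : ℤ) (s : ℂ) : dualWindow b c s = ∑' j : ℤ, dualTerm b c s j := rfl

/-- `|dualTerm| = e^{−π Re(b⁻¹)(j+σ)²}` at a real argument `σ`. [folklore] -/
theorem norm_dualTerm (b : ℂ) (c : ℤ) (σ : ℝ) (j : ℤ) :
    ‖dualTerm b c (σ : ℂ) j‖ = Real.exp (-π * (b⁻¹).re * ((j : ℝ) + σ) ^ 2) := by
  rw [dualTerm, norm_mul, show -2 * π * I * c * ((j : ℂ) + (σ : ℂ)) = ((-2 * π * c * (j + σ) : ℝ) : ℂ) * I by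
      push_cast; ring,
    Complex.norm_exp_ofReal_mul_I, mul_one, Complex.norm_exp]
  congr 1
  rw [show -π / b * ((j : ℂ) + (σ : ℂ)) ^ 2 = ((-π * ((j : ℝ) + σ) ^ 2 : ℝ) : ℂ) * b⁻¹ by push_cast; ring,
    re_ofReal_mul]
  ring

/-- `‖x‖² > 0` for `x ≠ 0` in `ℤⁿ`. [folklore] -/
theorem dotProduct_self_pos_int {x : Fin n → ℤ} (hx : x ≠ 0) : 0 < x ⬝ᵥ x := by
  obtain ⟨i, hi⟩ := Function.ne_iff.mp hx
  unfold dotProduct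
  exact Finset.sum_pos' (fun j _ => mul_self_nonneg _) ⟨i, Finset.mem_univ _, mul_self_pos.mpr hi⟩

/-- **A finite product of absolutely convergent series over `ℤ` is an absolutely convergent series over
`ℤᵈ`:** `∏ᵢ Σ_{m∈ℤ} fᵢ(m) = Σ_{m∈ℤᵈ} ∏ᵢ fᵢ(mᵢ)`. [folklore] -/
theorem prod_tsum_int {R : Type*} [NormedCommRing R] [NormOneClass R] [NormMulClass R] [CompleteSpace R]
    (d : ℕ) (f : Fin d → ℤ → R) (hf : ∀ i, Summable fun m => ‖f i m‖) :
    (Summable fun m : Fin d → ℤ => ‖∏ i, f i (m i)‖) ∧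
      ∏ i, ∑' m, f i m = ∑' m : Fin d → ℤ, ∏ i, f i (m i) := by
  induction d with
  | zero =>
      refine ⟨Summable.of_finite, ?_⟩
      simp
  | succ d ih =>
      obtain ⟨hS, hE⟩ := ih (fun i => f (Fin.succ i)) (fun i => hf (Fin.succ i))
      have hf0 : Summable fun m : ℤ => ‖f 0 m‖ := hf 0
      have h2 : Summable fun p : ℤ × (Fin d → ℤ) => ‖f 0 p.1 * ∏ i : Fin d, f (Fin.succ i) (p.2 i)‖ :=
        Summable.mul_norm (f := f 0) (g := fun m : Fin d → ℤ => ∏ i : Fin d, f (Fin.succ i) (m i)) hf0 hS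
      constructor
      · refine (Equiv.summable_iff (Fin.consEquiv fun _ => ℤ)).mp (h2.congr fun p => ?_)
        simp [Fin.prod_univ_succ]
      · rw [Fin.prod_univ_succ, hE,
          tsum_mul_tsum_of_summable_norm (f := f 0)
            (g := fun m : Fin d → ℤ => ∏ i : Fin d, f (Fin.succ i) (m i)) hf0 hS,
          ← (Fin.consEquiv fun _ => ℤ).tsum_eq]
        refine tsum_congr fun p => ?_
        simp [Fin.prod_univ_succ]

/-- **A uniform bound for the shifted theta series:** for `β > 0` there is `Θ` with
`Σ_{j∈ℤ} e^{−πβ(j+s)²} ≤ Θ` (and convergence) for every real `s` — reduce to `s ∈ [0,1)` by reindexing,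
then `(j+s)² ≥ j²/2 − 1`. [folklore] -/
theorem exists_theta_bound {β : ℝ} (hβ : 0 < β) :
    ∃ Θ : ℝ, ∀ s : ℝ, (Summable fun j : ℤ => Real.exp (-π * β * (j + s) ^ 2)) ∧
      ∑' j : ℤ, Real.exp (-π * β * (j + s) ^ 2) ≤ Θ := by
  have hmaj : Summable fun j : ℤ => Real.exp (-π * (β / 2) * (j : ℝ) ^ 2) := by
    have h := (summable_cexp_neg_quadratic (a := ((β / 2 : ℝ) : ℂ))
      (by rw [ofReal_re]; positivity) 0).norm
    refine h.congr fun j => ?_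
    rw [Complex.norm_exp]
    congr 1
    rw [show -π * ((β / 2 : ℝ) : ℂ) * (j : ℂ) ^ 2 + 2 * π * 0 * j
        = ((-π * (β / 2) * (j : ℝ) ^ 2 : ℝ) : ℂ) by push_cast; ring]
    exact ofReal_re _
  have hpt : ∀ r : ℝ, 0 ≤ r → r < 1 → ∀ j : ℤ,
      Real.exp (-π * β * (j + r) ^ 2) ≤ Real.exp (π * β) * Real.exp (-π * (β / 2) * (j : ℝ) ^ 2) := by
    intro r hr0 hr1 j
    rw [← Real.exp_add, Real.exp_le_exp]
    have H : (j : ℝ) ^ 2 ≤ 2 * (j + r) ^ 2 + 2 := by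
      nlinarith [sq_nonneg ((j : ℝ) + 2 * r), mul_nonneg hr0 (sub_nonneg.mpr hr1.le)]
    have hc : 0 ≤ π * β / 2 := by positivity
    nlinarith [mul_le_mul_of_nonneg_left H hc]
  refine ⟨Real.exp (π * β) * ∑' j : ℤ, Real.exp (-π * (β / 2) * (j : ℝ) ^ 2), fun s => ?_⟩
  set r : ℝ := Int.fract s with hr
  have hr0 : 0 ≤ r := Int.fract_nonneg s
  have hr1 : r < 1 := Int.fract_lt_one s
  have hs : s = (⌊s⌋ : ℝ) + r := by rw [hr, Int.floor_add_fract]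
  have hsum_r : Summable fun i : ℤ => Real.exp (-π * β * (i + r) ^ 2) :=
    Summable.of_nonneg_of_le (fun _ => (Real.exp_pos _).le) (hpt r hr0 hr1) (hmaj.mul_left _)
  have e1 : ∀ j : ℤ, Real.exp (-π * β * (j + s) ^ 2)
      = (fun i : ℤ => Real.exp (-π * β * (i + r) ^ 2)) (Equiv.addRight ⌊s⌋ j) := by
    intro j
    simp only [Equiv.coe_addRight, Int.cast_add]
    conv_lhs => rw [hs]
    congr 1
    ring
  have hS : Summable fun j : ℤ => Real.exp (-π * β * (j + s) ^ 2) :=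
    ((Equiv.summable_iff (Equiv.addRight ⌊s⌋)).mpr hsum_r).congr fun j => (e1 j).symm
  refine ⟨hS, ?_⟩
  calc ∑' j : ℤ, Real.exp (-π * β * (j + s) ^ 2)
      = ∑' j : ℤ, (fun i : ℤ => Real.exp (-π * β * (i + r) ^ 2)) (Equiv.addRight ⌊s⌋ j) :=
        tsum_congr e1
    _ = ∑' i : ℤ, Real.exp (-π * β * (i + r) ^ 2) :=
        Equiv.tsum_eq (Equiv.addRight ⌊s⌋) (fun i : ℤ => Real.exp (-π * β * (i + r) ^ 2))
    _ ≤ ∑' i : ℤ, Real.exp (π * β) * Real.exp (-π * (β / 2) * (i : ℝ) ^ 2) :=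
        hsum_r.tsum_le_tsum (hpt r hr0 hr1) (hmaj.mul_left _)
    _ = Real.exp (π * β) * ∑' j : ℤ, Real.exp (-π * (β / 2) * (j : ℝ) ^ 2) := tsum_mul_left

/-- **Fubini input.**  A double family `(k,m) ↦ F(k)·∏ᵢ Gₖ,ᵢ(mᵢ)` on `ℤ × ℤⁿ` is absolutely summable as soon as
`F` is, each `Gₖ,ᵢ` is absolutely summable, and `Σ_j |Gₖ,ᵢ(j)| ≤ Θ` uniformly. [folklore] -/
theorem summable_uncurry_mul_prod {F : ℤ → ℂ} (hF : Summable F) {G : ℤ → Fin n → ℤ → ℂ} {Θ : ℝ}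
    (hG : ∀ k i, Summable fun j => ‖G k i j‖) (hΘ : ∀ k i, ∑' j, ‖G k i j‖ ≤ Θ) :
    Summable (Function.uncurry fun (k : ℤ) (m : Fin n → ℤ) => F k * ∏ i, G k i (m i)) := by
  refine Summable.of_norm ?_
  rw [summable_prod_of_nonneg fun _ => norm_nonneg _]
  have hnorm : ∀ (k : ℤ) (m : Fin n → ℤ), ‖F k * ∏ i, G k i (m i)‖ = ‖F k‖ * ∏ i, ‖G k i (m i)‖ := by
    intro k m
    rw [norm_mul, norm_prod]
  simp only [Function.uncurry_apply_pair, hnorm]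
  have hP : ∀ k : ℤ, (Summable fun m : Fin n → ℤ => ‖∏ i, ‖G k i (m i)‖‖) ∧
      ∏ i, ∑' j, ‖G k i j‖ = ∑' m : Fin n → ℤ, ∏ i, ‖G k i (m i)‖ :=
    fun k => prod_tsum_int n (fun i j => ‖G k i j‖) (fun i => by simpa using hG k i)
  constructor
  · intro k
    exact (hP k).1.of_norm.mul_left _
  · refine Summable.of_nonneg_of_le (fun k => ?_) (fun k => ?_) (hF.norm.mul_right (Θ ^ n))
    · exact tsum_nonneg fun m => mul_nonneg (norm_nonneg _) (Finset.prod_nonneg fun i _ => norm_nonneg _)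
    · rw [tsum_mul_left, ← (hP k).2]
      refine mul_le_mul_of_nonneg_left ?_ (norm_nonneg _)
      calc ∏ i, ∑' j, ‖G k i j‖ ≤ ∏ _i : Fin n, Θ :=
            Finset.prod_le_prod (fun i _ => tsum_nonneg fun j => norm_nonneg _) fun i _ => hΘ k i
        _ = Θ ^ n := by rw [Finset.prod_const, Finset.card_univ, Fintype.card_fin]

/-! ### Expansions of the finite sums over the coordinates -/

/-- `Σᵢ (vᵢ + k uᵢ)² = ‖v‖² + 2k⟨u,v⟩ + k²‖u‖²`. [folklore] -/
theorem sum_add_mul_sq (v u : Fin n → ℂ) (k : ℂ) :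
    ∑ i, (v i + k * u i) ^ 2 = ∑ i, v i ^ 2 + 2 * k * ∑ i, u i * v i + k ^ 2 * ∑ i, u i ^ 2 := by
  rw [show ∑ i, (v i + k * u i) ^ 2 = ∑ i, (v i ^ 2 + 2 * k * (u i * v i) + k ^ 2 * u i ^ 2) from
    Finset.sum_congr rfl fun i _ => by ring]
  simp only [Finset.sum_add_distrib, ← Finset.mul_sum]

/-- `Σᵢ zᵢ(vᵢ + k uᵢ) = ⟨z,v⟩ + k⟨z,u⟩`. [folklore] -/
theorem sum_mul_add_mul (z v u : Fin n → ℂ) (k : ℂ) :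
    ∑ i, z i * (v i + k * u i) = ∑ i, z i * v i + k * ∑ i, z i * u i := by
  rw [show ∑ i, z i * (v i + k * u i) = ∑ i, (z i * v i + k * (z i * u i)) from
    Finset.sum_congr rfl fun i _ => by ring]
  simp only [Finset.sum_add_distrib, ← Finset.mul_sum]

/-- `Σᵢ (zᵢ − r uᵢ)(vᵢ + k uᵢ) = ⟨z,v⟩ + k⟨z,u⟩ − r(⟨u,v⟩ + k‖u‖²)` (the pairing `⟨d_j, m + w′⟩` of (24)).
[folklore] -/
theorem sum_sub_mul_add_mul (z u v : Fin n → ℂ) (r k : ℂ) :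
    ∑ i, (z i - u i * r) * (v i + k * u i)
      = (∑ i, z i * v i + k * ∑ i, z i * u i) - r * (∑ i, u i * v i + k * ∑ i, u i * u i) := by
  rw [show ∑ i, (z i - u i * r) * (v i + k * u i)
      = ∑ i, ((z i * v i + k * (z i * u i)) - r * (u i * v i + k * (u i * u i))) from
    Finset.sum_congr rfl fun i _ => by ring]
  simp only [Finset.sum_add_distrib, Finset.sum_sub_distrib, ← Finset.mul_sum]

/-- The shift `v = m + (h̃ − y)/P` (`h̃ ∈ [0,P)ⁿ`): the `k`-independent part of the dual-window argument
`mᵢ + (h̃ᵢ + kxᵢ − yᵢ)/P = vᵢ + (k/P)xᵢ`. [cite: ChenQuantumLattice2024, eq. (24) p. 26] -/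
def mShift (P : ℕ) (y : Fin n → ℤ) (h : Fin n → ZMod P) (m : Fin n → ℤ) : Fin n → ℂ :=
  fun i => (m i : ℂ) + ((((h i).val : ℤ) - y i : ℤ) : ℂ) / P

/-- **Poisson summation in `k` at fixed `m ∈ ℤⁿ`** (the step hidden in (22)(a)–(24)(a)): the `k`-series of
T1 at a fixed window index `m` is a Gaussian series in `k` of rate `α = (a + b⁻¹/P²)‖x‖²`, hence equals
`e^{E₀(m)} α^{−1/2} Σ_{j∈ℤ} e^{−(π/α)(j + iβ(m))²}` with `E₀(m) = −πa‖y‖² − πb⁻¹‖v‖² − 2πi⟨z′,v⟩`,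
`β(m) = a⟨x,y⟩ − ⟨x,v⟩b⁻¹/P − i⟨x,z′⟩/P`, `v = m + (h̃ − y)/P` (`mShift`).
[cite: ChenQuantumLattice2024, Lemma 2.4 p. 10; eq. (22)–(24) p. 25–26] -/
theorem tsum_line_dualTerm_fixed {P : ℕ} [NeZero P] {a b : ℂ} (ha : 0 < a.re) (hb : 0 < b.re)
    {x : Fin n → ℤ} (hx : x ≠ 0) (y z' : Fin n → ℤ) (h : Fin n → ZMod P) (m : Fin n → ℤ) :
    ∑' k : ℤ, cexp (-π * a * ∑ i, ((k * x i - y i : ℤ) : ℂ) ^ 2) *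
        ∏ i, dualTerm b (z' i) (((((h i).val : ℤ) + (k * x i - y i) : ℤ) : ℂ) / P) (m i)
      = cexp (-π * a * ((y ⬝ᵥ y : ℤ) : ℂ) - π * b⁻¹ * ∑ i, mShift P y h m i ^ 2
            - 2 * π * I * ∑ i, (z' i : ℂ) * mShift P y h m i)
        * (1 / ((a + b⁻¹ / (P : ℂ) ^ 2) * ((x ⬝ᵥ x : ℤ) : ℂ)) ^ (1 / 2 : ℂ)
          * ∑' j : ℤ, cexp (-π / ((a + b⁻¹ / (P : ℂ) ^ 2) * ((x ⬝ᵥ x : ℤ) : ℂ))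
              * (j + I * (a * ((x ⬝ᵥ y : ℤ) : ℂ) - (∑ i, (x i : ℂ) * mShift P y h m i) * b⁻¹ / P
                  - I * ((x ⬝ᵥ z' : ℤ) : ℂ) / P)) ^ 2)) := by
  have hP : (P : ℂ) ≠ 0 := by exact_mod_cast NeZero.ne P
  have hb0 : b ≠ 0 := fun h => by simp [h] at hb
  have hX1 : ∑ i, (x i : ℂ) * (x i : ℂ) = ((x ⬝ᵥ x : ℤ) : ℂ) := by
    rw [dotProduct]; push_cast; rfl
  have hX2 : ∑ i, (x i : ℂ) ^ 2 = ((x ⬝ᵥ x : ℤ) : ℂ) := by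
    rw [dotProduct]; push_cast; simp only [sq]
  have hζ : ∑ i, (z' i : ℂ) * (x i : ℂ) = ((x ⬝ᵥ z' : ℤ) : ℂ) := by
    rw [dotProduct]; push_cast; exact Finset.sum_congr rfl fun i _ => mul_comm _ _
  have harg : ∀ (k : ℤ) (i : Fin n), ((m i : ℤ) : ℂ) + ((((h i).val : ℤ) + (k * x i - y i) : ℤ) : ℂ) / P
      = mShift P y h m i + (k : ℂ) / P * (x i : ℂ) := by
    intro k i
    simp only [mShift]
    push_cast
    ring
  have hterm : ∀ k : ℤ, cexp (-π * a * ∑ i, ((k * x i - y i : ℤ) : ℂ) ^ 2) *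
        ∏ i, dualTerm b (z' i) (((((h i).val : ℤ) + (k * x i - y i) : ℤ) : ℂ) / P) (m i)
      = cexp (-π * a * ((y ⬝ᵥ y : ℤ) : ℂ) - π * b⁻¹ * ∑ i, mShift P y h m i ^ 2
            - 2 * π * I * ∑ i, (z' i : ℂ) * mShift P y h m i)
        * cexp (-π * ((a + b⁻¹ / (P : ℂ) ^ 2) * ((x ⬝ᵥ x : ℤ) : ℂ)) * k ^ 2
            + 2 * π * (a * ((x ⬝ᵥ y : ℤ) : ℂ) - (∑ i, (x i : ℂ) * mShift P y h m i) * b⁻¹ / P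
                  - I * ((x ⬝ᵥ z' : ℤ) : ℂ) / P) * k) := by
    intro k
    have e1 : (∑ i, ((k * x i - y i : ℤ) : ℂ) ^ 2)
        = (k : ℂ) ^ 2 * ((x ⬝ᵥ x : ℤ) : ℂ) - 2 * k * ((x ⬝ᵥ y : ℤ) : ℂ) + ((y ⬝ᵥ y : ℤ) : ℂ) := by
      push_cast
      exact sum_sq_line x y k
    have e2 : ∏ i, dualTerm b (z' i) (((((h i).val : ℤ) + (k * x i - y i) : ℤ) : ℂ) / P) (m i)
        = cexp (∑ i, (-π / b * (mShift P y h m i + (k : ℂ) / P * (x i : ℂ)) ^ 2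
            + -2 * π * I * (z' i : ℂ) * (mShift P y h m i + (k : ℂ) / P * (x i : ℂ)))) := by
      rw [Complex.exp_sum]
      refine Finset.prod_congr rfl fun i _ => ?_
      rw [Complex.exp_add, dualTerm, harg k i]
    rw [e1, e2, ← Complex.exp_add, ← Complex.exp_add]
    congr 1
    rw [Finset.sum_add_distrib, show ∑ i, -π / b * (mShift P y h m i + (k : ℂ) / P * (x i : ℂ)) ^ 2
        = -π / b * ∑ i, (mShift P y h m i + (k : ℂ) / P * (x i : ℂ)) ^ 2 by rw [Finset.mul_sum],
      sum_add_mul_sq, show ∑ i, -2 * π * I * (z' i : ℂ) * (mShift P y h m i + (k : ℂ) / P * (x i : ℂ))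
        = -2 * π * I * ∑ i, (z' i : ℂ) * (mShift P y h m i + (k : ℂ) / P * (x i : ℂ)) by
          rw [Finset.mul_sum]; exact Finset.sum_congr rfl fun i _ => by ring,
      sum_mul_add_mul, hX2, hζ]
    ring
  have hα : 0 < ((a + b⁻¹ / (P : ℂ) ^ 2) * ((x ⬝ᵥ x : ℤ) : ℂ)).re := by
    apply re_mul_dotProduct_self_pos _ hx
    have hbi : 0 < (b⁻¹).re := by
      rw [inv_re]
      exact div_pos hb (Complex.normSq_pos.mpr hb0)
    rw [add_re, show (P : ℂ) ^ 2 = ((P ^ 2 : ℕ) : ℂ) by rw [Nat.cast_pow], div_natCast_re]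
    exact add_pos_of_pos_of_nonneg ha (div_nonneg hbi.le (Nat.cast_nonneg _))
  simp_rw [hterm]
  rw [tsum_mul_left, Complex.tsum_exp_neg_quadratic hα]

/-! ### Eq. (23): `Σ`, `d_j`, `C_j`, and the shift of (24) -/

/-- The quadratic form of `Σ = t⁻²(Iₙ − xxᵀ/(t² + ‖x‖²)) = (t²Iₙ + xxᵀ)⁻¹` (eq. (23)(b), Formula (8)):
`vᵀΣv = (‖v‖² − ⟨x,v⟩²/(t²+‖x‖²))/t²`. [cite: ChenQuantumLattice2024, eq. (23) p. 25] -/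
def sigmaForm (t : ℝ) (x : Fin n → ℤ) (v : Fin n → ℂ) : ℂ :=
  (∑ i, v i ^ 2 - (∑ i, (x i : ℂ) * v i) ^ 2 / ((t : ℂ) ^ 2 + ((x ⬝ᵥ x : ℤ) : ℂ))) / (t : ℂ) ^ 2

/-- `d_j := z′ − x(Pj + ⟨x,z′⟩)/(t² + ‖x‖²)` (eq. (23)). [cite: ChenQuantumLattice2024, eq. (23) p. 25] -/
def dVec (P : ℕ) (t : ℝ) (x z' : Fin n → ℤ) (j : ℤ) : Fin n → ℂ :=
  fun i => (z' i : ℂ) - (x i : ℂ) * (((P : ℂ) * j + ((x ⬝ᵥ z' : ℤ) : ℂ)) / ((t : ℂ) ^ 2 + ((x ⬝ᵥ x : ℤ) : ℂ)))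

/-- `C_j := t²(Pj + ⟨x,z′⟩)²/(t² + ‖x‖²)` (eq. (23)). [cite: ChenQuantumLattice2024, eq. (23) p. 25] -/
def cTerm (P : ℕ) (t : ℝ) (x z' : Fin n → ℤ) (j : ℤ) : ℂ :=
  (t : ℂ) ^ 2 * ((P : ℂ) * j + ((x ⬝ᵥ z' : ℤ) : ℂ)) ^ 2 / ((t : ℂ) ^ 2 + ((x ⬝ᵥ x : ℤ) : ℂ))

/-- The real shift `w′ = h/P + ⟨x,y⟩x/(‖x‖²P) − y/P` of (24) (display `=(a)`, p. 26; `h` read in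
`[0,P)` — any representative gives the same state, the sum over `m ∈ ℤⁿ` absorbing the difference).
[cite: ChenQuantumLattice2024, eq. (24) p. 26] -/
def wShift (P : ℕ) (x y : Fin n → ℤ) (h : Fin n → ZMod P) : Fin n → ℂ :=
  fun i => ((((h i).val : ℕ) : ℂ) + ((x ⬝ᵥ y : ℤ) : ℂ) / ((x ⬝ᵥ x : ℤ) : ℂ) * (x i : ℂ) - (y i : ℂ)) / P

/-- **The exponent bookkeeping of (22)–(24)** (incl. Lemma 3.21's completion of the square and (23)(b)):
with `T = t²`, `X = ‖x‖²`, `Sxy = ⟨x,y⟩`, `Syy = ‖y‖²`, `ζ = ⟨x,z′⟩`, `vv = ‖v‖²`, `p = ⟨x,v⟩`, `q = ⟨z′,v⟩`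
(`v = m + (h̃−y)/P`), the exponent produced by T1 + Poisson summation in `k` (left) equals the exponent
printed in (24) plus the global constant `−πa(‖y‖² − ⟨x,y⟩²/‖x‖²)` (right), identically. [folklore] -/
theorem eq24_exponent_identity (a T P X Sxy Syy ζ vv p q j : ℂ)
    (ha : a ≠ 0) (hT : T ≠ 0) (hP : P ≠ 0) (hX : X ≠ 0) (hTX : T + X ≠ 0) :
    (-π * a * Syy - π * (P ^ 2 * X * a / T) * vv - 2 * π * I * q)
      + -π / (a * X * (T + X) / T)
          * (j + I * (a * Sxy - p * (P ^ 2 * X * a / T) / P - I * ζ / P)) ^ 2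
    = -π * a * (Syy - Sxy ^ 2 / X)
      + (-π * (P ^ 2 * X * a) * ((vv + 2 * (Sxy / X / P) * p + (Sxy / X / P) ^ 2 * X
            - (p + Sxy / X / P * X) ^ 2 / (T + X)) / T)
        + (-2 * π * I * (q + Sxy / X / P * ζ - (P * j + ζ) / (T + X) * (p + Sxy / X / P * X))
          + (-2 * π * I * (Sxy / X) * j
            + -π / (P ^ 2 * X * a) * (T * (P * j + ζ) ^ 2 / (T + X))))) := by
  have h1 : j + I * (a * Sxy - p * (P ^ 2 * X * a / T) / P - I * ζ / P)
      = (j + ζ / P) + I * (a * Sxy - p * (P ^ 2 * X * a / T) / P) := by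
    linear_combination (-ζ / P) * I_sq
  rw [h1, show ((j + ζ / P) + I * (a * Sxy - p * (P ^ 2 * X * a / T) / P)) ^ 2
      = (j + ζ / P) ^ 2 + 2 * (j + ζ / P) * (a * Sxy - p * (P ^ 2 * X * a / T) / P) * I
        - (a * Sxy - p * (P ^ 2 * X * a / T) / P) ^ 2 by
      linear_combination (a * Sxy - p * (P ^ 2 * X * a / T) / P) ^ 2 * I_sq]
  field_simp
  ring

/-- Bookkeeping of the global constants between T1 + Poisson summation and (24). [folklore] -/
theorem tsum_const_rearrange {ι : Type*} (Cb Cα C₀ : ℂ) (E S Q SR : ι → ℂ)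
    (hES : ∀ m, E m * S m = C₀ * (Q m * SR m)) :
    Cb * ∑' m, E m * (Cα * S m) = C₀ * Cb * Cα * ∑' m, Q m * SR m := by
  have h : ∀ m, E m * (Cα * S m) = (C₀ * Cα) * (Q m * SR m) := fun m => by
    rw [mul_left_comm, hES]
    ring
  simp_rw [h]
  rw [tsum_mul_left]
  ring

/-- **T2 — eq. (24), exactly (p. 26, display `=(a)`, sum over `m ∈ ℤⁿ`).**  With the window rate of
(19)–(21), `b = t²/(P²‖x‖²a)` (`t ≠ 0` real, `a = κ_{r,s}`, correct guess `u² = ‖x‖²`), for every `h ∈ ℤ_Pⁿ`: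
`|φ₄⟩(h) = e^{−πa(‖y‖²−⟨x,y⟩²/‖x‖²)} · b^{−n/2} · α^{−1/2} · Σ_{m∈ℤⁿ} exp(−π P²‖x‖²a · (m+w′)ᵀΣ(m+w′)) ·
Σ_{j∈ℤ} e^{−2πi⟨d_j, m+w′⟩} e^{−2πi(⟨x,y⟩/‖x‖²)j} e^{−π C_j/(P²‖x‖²a)}` with `w′ = (h̃ + ⟨x,y⟩x/‖x‖² − y)/P`,
`α = a‖x‖²(t²+‖x‖²)/t²`, and `Σ`, `d_j`, `C_j` of (23) (`P²‖x‖²a = P²‖x‖²(s²+r²i)/(s²r²)`,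
`1/(P²‖x‖²a) = s²r²(s²−r²i)/(P²‖x‖²(s⁴+r⁴))` for `a = κ_{r,s}`, `inv_karstRate`).  The three factors in
front are the global amplitude the paper drops ((18)(a), (22)(a)); the double series is (24) verbatim
(a sign-flipped variant of the phase `e^{−2πi(⟨x,y⟩/‖x‖²)j}` is rejected by the kernel — negative control
kept in the session folder).  Route: T1, `prod_tsum_int`, Fubini (`summable_uncurry_mul_prod`,
`exists_theta_bound`), Poisson summation in `k` (`tsum_line_dualTerm_fixed`), and the identity
`eq24_exponent_identity`; the paper's "(a) uses PSF from `Σ_{z∈ℤⁿ}` to `Σ_{m∈ℤⁿ}`" is thus certified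
without any `n`-dimensional Poisson summation.
[cite: ChenQuantumLattice2024, eq. (22)–(24) p. 25–26; Lemma 3.21; Lemma 2.4 p. 10] -/
theorem phi4_eq24 {P : ℕ} [NeZero P] {a : ℂ} (ha : 0 < a.re) {x : Fin n → ℤ} (hx : x ≠ 0)
    (y z' : Fin n → ℤ) {t : ℝ} (ht : t ≠ 0) (h : Fin n → ZMod P) :
    phi4 P a ((t : ℂ) ^ 2 / ((P : ℂ) ^ 2 * ((x ⬝ᵥ x : ℤ) : ℂ) * a)) x y z' h
      = cexp (-π * a * (((y ⬝ᵥ y : ℤ) : ℂ) - ((x ⬝ᵥ y : ℤ) : ℂ) ^ 2 / ((x ⬝ᵥ x : ℤ) : ℂ)))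
        * (1 / ((t : ℂ) ^ 2 / ((P : ℂ) ^ 2 * ((x ⬝ᵥ x : ℤ) : ℂ) * a)) ^ (1 / 2 : ℂ)) ^ n
        * (1 / (a * ((x ⬝ᵥ x : ℤ) : ℂ) * ((t : ℂ) ^ 2 + ((x ⬝ᵥ x : ℤ) : ℂ)) / (t : ℂ) ^ 2) ^ (1 / 2 : ℂ))
        * ∑' m : Fin n → ℤ,
            cexp (-π * ((P : ℂ) ^ 2 * ((x ⬝ᵥ x : ℤ) : ℂ) * a)
                * sigmaForm t x (fun i => (m i : ℂ) + wShift P x y h i))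
            * ∑' j : ℤ, cexp (-2 * π * I * ∑ i, dVec P t x z' j i * ((m i : ℂ) + wShift P x y h i))
                * cexp (-2 * π * I * (((x ⬝ᵥ y : ℤ) : ℂ) / ((x ⬝ᵥ x : ℤ) : ℂ)) * j)
                * cexp (-π / ((P : ℂ) ^ 2 * ((x ⬝ᵥ x : ℤ) : ℂ) * a) * cTerm P t x z' j) := by
  -- nonvanishing and positivity of the constants
  have hP0 : 0 < P := Nat.pos_of_ne_zero (NeZero.ne P)
  have hP : (P : ℂ) ≠ 0 := by exact_mod_cast NeZero.ne P
  have ha0 : a ≠ 0 := fun h => by simp [h] at ha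
  have hxx : 0 < x ⬝ᵥ x := dotProduct_self_pos_int hx
  have hX : ((x ⬝ᵥ x : ℤ) : ℂ) ≠ 0 := by exact_mod_cast hxx.ne'
  have hT : (t : ℂ) ^ 2 ≠ 0 := pow_ne_zero 2 (by exact_mod_cast ht)
  have ht' : (t : ℂ) ≠ 0 := by exact_mod_cast ht
  have hXr : (0 : ℝ) < ((x ⬝ᵥ x : ℤ) : ℝ) := by exact_mod_cast hxx
  have hPr : (0 : ℝ) < (P : ℝ) := by exact_mod_cast hP0
  have htr : (0 : ℝ) < t ^ 2 := by positivity
  have hTX : (t : ℂ) ^ 2 + ((x ⬝ᵥ x : ℤ) : ℂ) ≠ 0 := by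
    have h1 : (0 : ℝ) < t ^ 2 + ((x ⬝ᵥ x : ℤ) : ℝ) := add_pos htr hXr
    exact_mod_cast h1.ne'
  have hainv : 0 < (a⁻¹).re := by
    rw [inv_re]
    exact div_pos ha (Complex.normSq_pos.mpr ha0)
  -- the window rate `b = t²/(P²‖x‖²a)` has positive real part, and so has its inverse
  have hb : 0 < ((t : ℂ) ^ 2 / ((P : ℂ) ^ 2 * ((x ⬝ᵥ x : ℤ) : ℂ) * a)).re := by
    have e : (t : ℂ) ^ 2 / ((P : ℂ) ^ 2 * ((x ⬝ᵥ x : ℤ) : ℂ) * a)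
        = ((t ^ 2 / ((P : ℝ) ^ 2 * ((x ⬝ᵥ x : ℤ) : ℝ)) : ℝ) : ℂ) * a⁻¹ := by
      push_cast
      ring
    rw [e, re_ofReal_mul]
    exact mul_pos (div_pos htr (mul_pos (pow_pos hPr 2) hXr)) hainv
  have hb0 : (t : ℂ) ^ 2 / ((P : ℂ) ^ 2 * ((x ⬝ᵥ x : ℤ) : ℂ) * a) ≠ 0 := by
    intro h0
    rw [h0, Complex.zero_re] at hb
    exact lt_irrefl _ hb
  have hbinv : ((t : ℂ) ^ 2 / ((P : ℂ) ^ 2 * ((x ⬝ᵥ x : ℤ) : ℂ) * a))⁻¹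
      = (P : ℂ) ^ 2 * ((x ⬝ᵥ x : ℤ) : ℂ) * a / (t : ℂ) ^ 2 := inv_div _ _
  have hβ : 0 < (((t : ℂ) ^ 2 / ((P : ℂ) ^ 2 * ((x ⬝ᵥ x : ℤ) : ℂ) * a))⁻¹).re := by
    rw [inv_re]
    exact div_pos hb (Complex.normSq_pos.mpr hb0)
  obtain ⟨Θ, hΘ⟩ := exists_theta_bound hβ
  -- abbreviations: the window rate, the real shift `(h̃ᵢ + kxᵢ − yᵢ)/P`
  set b : ℂ := (t : ℂ) ^ 2 / ((P : ℂ) ^ 2 * ((x ⬝ᵥ x : ℤ) : ℂ) * a) with hbdef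
  have hsreal : ∀ (k : ℤ) (i : Fin n), ((((h i).val : ℤ) + (k * x i - y i) : ℤ) : ℂ) / P
      = ((((((h i).val : ℤ) + (k * x i - y i) : ℤ) : ℝ) / P : ℝ) : ℂ) := by
    intro k i
    rw [ofReal_div, ofReal_intCast, ofReal_natCast]
  have hnormG : ∀ (k : ℤ) (i : Fin n) (j : ℤ),
      ‖dualTerm b (z' i) (((((h i).val : ℤ) + (k * x i - y i) : ℤ) : ℂ) / P) j‖
        = Real.exp (-π * (b⁻¹).re * ((j : ℝ) + (((((h i).val : ℤ) + (k * x i - y i) : ℤ) : ℝ) / P)) ^ 2) := by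
    intro k i j
    rw [hsreal, norm_dualTerm]
  have hGsum : ∀ (k : ℤ) (i : Fin n),
      Summable fun j => ‖dualTerm b (z' i) (((((h i).val : ℤ) + (k * x i - y i) : ℤ) : ℂ) / P) j‖ := by
    intro k i
    simp_rw [hnormG]
    exact (hΘ _).1
  have hGle : ∀ (k : ℤ) (i : Fin n),
      ∑' j, ‖dualTerm b (z' i) (((((h i).val : ℤ) + (k * x i - y i) : ℤ) : ℂ) / P) j‖ ≤ Θ := by
    intro k i
    simp_rw [hnormG]
    exact (hΘ _).2
  have hF : Summable fun k : ℤ => cexp (-π * a * ∑ i, ((k * x i - y i : ℤ) : ℂ) ^ 2) :=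
    summable_lineWindow ha hx y
  -- T1, then products of dual windows as series over ℤⁿ
  rw [phi4_apply ha hb hx]
  have hstep2 : ∀ k : ℤ, cexp (-π * a * ∑ i, ((k * x i - y i : ℤ) : ℂ) ^ 2) *
        ∏ i, dualWindow b (z' i) (((((h i).val : ℤ) + (k * x i - y i) : ℤ) : ℂ) / P)
      = ∑' m : Fin n → ℤ, cexp (-π * a * ∑ i, ((k * x i - y i : ℤ) : ℂ) ^ 2) *
          ∏ i, dualTerm b (z' i) (((((h i).val : ℤ) + (k * x i - y i) : ℤ) : ℂ) / P) (m i) := by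
    intro k
    simp_rw [dualWindow_eq_tsum]
    rw [(prod_tsum_int n _ (hGsum k)).2, tsum_mul_left]
  simp_rw [hstep2]
  -- Fubini on ℤ × ℤⁿ
  have hsum := summable_uncurry_mul_prod hF hGsum hGle
  rw [← hsum.tsum_comm]
  -- Poisson summation in k, for every m
  simp_rw [tsum_line_dualTerm_fixed ha hb hx y z' h]
  -- the dual rate α in closed form
  have hα : (a + b⁻¹ / (P : ℂ) ^ 2) * ((x ⬝ᵥ x : ℤ) : ℂ)
      = a * ((x ⬝ᵥ x : ℤ) : ℂ) * ((t : ℂ) ^ 2 + ((x ⬝ᵥ x : ℤ) : ℂ)) / (t : ℂ) ^ 2 := by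
    rw [hbinv]
    field_simp
  simp_rw [hα]
  -- pull the constants out and compare term by term
  refine tsum_const_rearrange _ _ _ _ _ _ _ fun m => ?_
  simp only [← tsum_mul_left]
  refine tsum_congr fun j => ?_
  simp only [← Complex.exp_add]
  congr 1
  have hX1 : ∑ i, (x i : ℂ) * (x i : ℂ) = ((x ⬝ᵥ x : ℤ) : ℂ) := by
    rw [dotProduct]; push_cast; rfl
  have hX2 : ∑ i, (x i : ℂ) ^ 2 = ((x ⬝ᵥ x : ℤ) : ℂ) := by
    rw [dotProduct]; push_cast; simp only [sq]
  have hζ : ∑ i, (z' i : ℂ) * (x i : ℂ) = ((x ⬝ᵥ z' : ℤ) : ℂ) := by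
    rw [dotProduct]; push_cast; exact Finset.sum_congr rfl fun i _ => mul_comm _ _
  have W1 : ∀ i, (m i : ℂ) + wShift P x y h i
      = mShift P y h m i + ((x ⬝ᵥ y : ℤ) : ℂ) / ((x ⬝ᵥ x : ℤ) : ℂ) / P * (x i : ℂ) := by
    intro i
    simp only [wShift, mShift]
    push_cast
    ring
  simp only [sigmaForm, dVec, cTerm, W1]
  rw [sum_sub_mul_add_mul, sum_add_mul_sq, sum_mul_add_mul, hX1, hX2, hζ, hbinv]
  linear_combination eq24_exponent_identity a ((t : ℂ) ^ 2) P ((x ⬝ᵥ x : ℤ) : ℂ) ((x ⬝ᵥ y : ℤ) : ℂ)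
    ((y ⬝ᵥ y : ℤ) : ℂ) ((x ⬝ᵥ z' : ℤ) : ℂ) (∑ i, mShift P y h m i ^ 2) (∑ i, (x i : ℂ) * mShift P y h m i)
    (∑ i, (z' i : ℂ) * mShift P y h m i) j ha0 hT hP hX hTX

end StepFour

end

end Literature.Computability.Cryptography.Chen2024
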